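import Summits.BirchSwinnertonDyer.Rank1Residual.Additive.GreenbergKummerTwistDescent
import Summits.BirchSwinnertonDyer.Rank1Residual.AdditivePotMult.TwistTransportLocal
import Summits.BirchSwinnertonDyer.Rank1Residual.AdditivePotMult.VariableChangeSelmerOver
import HarnessLib

/-!
# The 'Greenberg ⊆ Kummer' inclusion over `ℚ_∞` for `E = C • V^{(c)}`: the INSTANCE of the end
# theorem of row T-RD-Δ-K for additive-p1's geometric twist transport
# `t = twistPrimaryEquiv⁻¹ ≫ primaryIso`, with the Kummer square DISCHARGED (cell `b2b-bsdres`, team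
# n1011, row T-RD-Δ-K; lead R5-40 (b); referee-1 ACK-1 v4; seat n1011-p05 gen 3)

HONEST FRAMING (cell `b2b-bsdres`, run/shared/lean/b2b/bsd-rank1-residual/, verbatim in every
file): the goal of the cell is to DELETE the COMBINATION-SHAPED residual classes of the
Birch–Swinnerton-Dyer formula for ALL analytic-rank `≤ 1` elliptic curves over `ℚ` — "full BSD
formula for every rank `≤ 1` curve in class `C`" assembled STRICTLY from published theorems — so
that the rank-`≤ 1` remainder becomes exactly the CONSTRUCTION-SHAPED classes, which are TYPED
(missing-input `Prop`s), NOT attempted. This is not "finishing BSD". Team n1011 (X4 ∧ `p = 3`,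
§I N10/N11; ROUTE-2 of planner r2): research route; TOOL theorems + ONE assembly CONDITIONAL on
the typed published fact `Greenberg1999.imKummer_ge_strictCondition_goodOrdinary` (cc-typer-2,
p262636) taken as the hypothesis `hGrK` (referee 1, R1); no definition, no named fact by this seat;
nothing booked; no label changes.

## What

`GreenbergKummerTwistDescent.greenbergKer_twistMap_kerSubgroup_le_localKerOver` is generic in the
transport `t : V[p^∞] ≃+ W[p^∞]` and carries the Kummer square `hKum` as a hypothesis. For the
transport built from additive-p1's `twistPrimaryEquiv : V^{(c)}[p^∞] ≃+ V[p^∞]` (sign rules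
`twistPrimaryEquiv_smul_of_mem / _of_not_mem`) and the change of variables `primaryIso p hC :
V^{(c)}[p^∞] ≃+ W[p^∞]` (`C • V^{(c)} = W`), every hypothesis is a tree theorem:

* sign rule and `galRange K`-equivariance (`geomTransport_smul_of_mem / _of_not_mem / _sign`);
* the inertial anti-witness for `ord_v c = 1` (`exists_mem_absInertia_geomTransport_smul_eq_neg`,
  the Kummer-theory step of p10's `exists_mem_absInertia_twistTransport_smul_eq_neg`);
* **the Kummer square** `mem_localKerOver_iff_h1Equiv_geomTransport` = additive-p1's
  `TwistTransportLocal.mem_localKerOver_iff_twist` ∘ `VariableChangeSelmerOver.mem_localKerOver_iff_model`;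
* **`greenbergKer_twistMap_geomTransport_le_localKerOver`** — the end theorem with ONLY `hGrK` (the
  typed fact), `p ≠ 2`, good ordinary `V` at `p`, cyclotomic `κ`, `ord_v c = 1` as hypotheses.

References: [GreenbergLNM1716] §2 Props. 2.2, 2.4 (pp. 73–75); [SilvermanAEC2009] X.5 Cor. 5.4;
[SerreInventiones1972] §1.3.
-/

noncomputable section

open scoped Classical

namespace Summit.BirchSwinnertonDyer.Rank1Residual.Additive.TameDescent

open NumberField IsDedekindDomain Field Literature.NumberTheory.GaloisRepresentations
  Literature.NumberTheory.EllipticCurves Literature.NumberTheory.EllipticCurves.GreenbergSelmer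
  Literature.NumberTheory.EllipticCurves.Greenberg1999 WeierstrassCurve
  Summit.BirchSwinnertonDyer.Rank1Residual.X2.GreenbergVatsalReductionDatum
  Summit.BirchSwinnertonDyer.Rank1Residual.GaloisImage
  Summit.BirchSwinnertonDyer.Rank1Residual.GaloisImage.RamifiedOrdinaryLineTwist
  Summit.BirchSwinnertonDyer.Rank1Residual.AdditivePotMult

variable (V : WeierstrassCurve ℚ) (K : Type) [Field K] [NumberField K]
  (h2 : Module.finrank ℚ K = 2) {θ : K} {c : ℚ} (hθ : θ ∉ Set.range (algebraMap ℚ K))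
  (hc : θ ^ 2 = algebraMap ℚ K c) (p : ℕ) {W : WeierstrassCurve ℚ} {C : VariableChange ℚ}
  (hC : C • V.quadraticTwist c = W)

/-! ## §1 The geometric transport `V[p^∞] ≃+ W[p^∞]` and its sign rules -/

/-- `+` on `galRange K`: `(ψ̃⁻¹ ≫ C)(g • m) = g • (ψ̃⁻¹ ≫ C)(m)`. [cite: SilvermanAEC2009, X.5 Cor. 5.4] -/
theorem geomTransport_smul_of_mem {g : absoluteGaloisGroup ℚ} (hg : g ∈ galRange (K := ℚ) K)
    (m : V.geomPrimaryTorsion p) :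
    ((twistPrimaryEquiv V K hθ hc p).symm.trans (primaryIso p hC)) (g • m) =
      g • ((twistPrimaryEquiv V K hθ hc p).symm.trans (primaryIso p hC)) m := by
  rw [AddEquiv.trans_apply, AddEquiv.trans_apply, ← primaryIso_smul]
  congr 1
  apply (twistPrimaryEquiv V K hθ hc p).injective
  rw [AddEquiv.apply_symm_apply, twistPrimaryEquiv_smul_of_mem V K hθ hc p hg,
    AddEquiv.apply_symm_apply]

include h2 in
/-- `−` off `galRange K`. [cite: SilvermanAEC2009, X.5 Cor. 5.4] [cite: Dokchitser2013ParityNotes, §4] -/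
theorem geomTransport_smul_of_not_mem {g : absoluteGaloisGroup ℚ} (hg : g ∉ galRange (K := ℚ) K)
    (m : V.geomPrimaryTorsion p) :
    ((twistPrimaryEquiv V K hθ hc p).symm.trans (primaryIso p hC)) (g • m) =
      -(g • ((twistPrimaryEquiv V K hθ hc p).symm.trans (primaryIso p hC)) m) := by
  rw [AddEquiv.trans_apply, AddEquiv.trans_apply, ← primaryIso_smul, ← map_neg]
  congr 1
  apply (twistPrimaryEquiv V K hθ hc p).injective
  rw [AddEquiv.apply_symm_apply, map_neg, twistPrimaryEquiv_smul_of_not_mem V K h2 hθ hc p hg,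
    AddEquiv.apply_symm_apply, neg_neg]

include h2 in
/-- The sign rule. [cite: SilvermanAEC2009, X.5 Cor. 5.4] -/
theorem geomTransport_sign (g : absoluteGaloisGroup ℚ) :
    (∀ m, ((twistPrimaryEquiv V K hθ hc p).symm.trans (primaryIso p hC)) (g • m) =
        g • ((twistPrimaryEquiv V K hθ hc p).symm.trans (primaryIso p hC)) m) ∨
      (∀ m, ((twistPrimaryEquiv V K hθ hc p).symm.trans (primaryIso p hC)) (g • m) =
        -(g • ((twistPrimaryEquiv V K hθ hc p).symm.trans (primaryIso p hC)) m)) := by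
  by_cases hg : g ∈ galRange (K := ℚ) K
  · exact Or.inl fun m ↦ geomTransport_smul_of_mem V K hθ hc p hC hg m
  · exact Or.inr fun m ↦ geomTransport_smul_of_not_mem V K h2 hθ hc p hC hg m

include h2 hc in
/-- **The ramified inertia witness** (`p ∈ v`, `p ≠ 2`, `ord_v c = 1`): some `σ ∈ I_{ℚ_v}` moves
`√c` to `−√c`, hence lies off `galRange K` and the transport is anti-equivariant at `res σ` — the
Kummer-theory step of p10's `exists_mem_absInertia_twistTransport_smul_eq_neg`, verbatim.
[cite: SerreInventiones1972, §1.3] [cite: SilvermanAEC2009, X.5 Cor. 5.4] -/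
theorem exists_mem_absInertia_geomTransport_smul_eq_neg [Fact p.Prime] (hp2 : p ≠ 2)
    {v : HeightOneSpectrum (𝓞 ℚ)} (hv : ((p : ℕ) : 𝓞 ℚ) ∈ v.asIdeal)
    (hval : v.valuation ℚ c = WithZero.exp (-1 : ℤ)) :
    ∃ σ ∈ absInertia (v.adicCompletion ℚ), ∀ m : V.geomPrimaryTorsion p,
      ((twistPrimaryEquiv V K hθ hc p).symm.trans (primaryIso p hC))
          (absGaloisRestrict ℚ (v.adicCompletion ℚ) σ • m) =
        -(absGaloisRestrict ℚ (v.adicCompletion ℚ) σ •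
          ((twistPrimaryEquiv V K hθ hc p).symm.trans (primaryIso p hC)) m) := by
  have hζ : IsPrimitiveRoot (-1 : AlgebraicClosure ℚ) 2 := IsPrimitiveRoot.neg_one 0 (by decide)
  have h2v : ((2 : ℕ) : 𝓞 ℚ) ∉ v.asIdeal := by
    exact_mod_cast two_not_mem_of_natCast_prime_mem (Fact.out : p.Prime) hp2 hv
  obtain ⟨σ, hσ, hσθ⟩ := exists_mem_absInertia_adicCompletion_smul_eq_pow_mul ℚ v two_pos hζ h2v
    hval (embIntoClosure_sq K hc) 1
  refine ⟨σ, hσ, fun m ↦ geomTransport_smul_of_not_mem V K h2 hθ hc p hC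
    (not_mem_galRange_of_smul_embIntoClosure_ne K (θ := θ) ?_) m⟩
  rw [hσθ, pow_one, neg_one_mul]
  intro h
  have hθ0 : embIntoClosure (K := ℚ) K θ ≠ 0 := by
    intro h0
    apply Literature.NumberTheory.QuadraticFields.Quadratic.ne_zero_of_not_mem_range hθ
    exact (embIntoClosure (K := ℚ) K).injective (h0.trans (map_zero _).symm)
  have h2' : (2 : AlgebraicClosure ℚ) * embIntoClosure (K := ℚ) K θ = 0 := by linear_combination -h
  exact hθ0 ((mul_eq_zero.1 h2').resolve_left two_ne_zero)

/-! ## §2 The Kummer square for the geometric transport -/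

/-- **Kummer sides correspond under the geometric transport** at every `H ≤ galRange K` and every
`ℚ`-field `E`: `s ∈ V.localKerOver p H E ↔ t_* s ∈ W.localKerOver p H E` — additive-p1's twist
square (`mem_localKerOver_iff_twist`, backwards) followed by the change-of-model square
(`mem_localKerOver_iff_model`). [cite: GreenbergLNM1716, §2] [cite: SilvermanAEC2009, X.5 Cor. 5.4] -/
theorem mem_localKerOver_iff_h1Equiv_geomTransport (H : Subgroup (absoluteGaloisGroup ℚ))
    (hH : H ≤ galRange (K := ℚ) K)
    (hθH : ∀ (g : H) (m : V.geomPrimaryTorsion p),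
      ((twistPrimaryEquiv V K hθ hc p).symm.trans (primaryIso p hC)) (g • m) =
        g • ((twistPrimaryEquiv V K hθ hc p).symm.trans (primaryIso p hC)) m)
    (E : Type) [Field E] [Algebra ℚ E] (s : V.subgroupH1 p H) :
    s ∈ V.localKerOver p H E ↔
      h1Equiv (G := H) ((twistPrimaryEquiv V K hθ hc p).symm.trans (primaryIso p hC)) hθH s ∈
        W.localKerOver p H E := by
  have step1 := mem_localKerOver_iff_twist V K hθ hc p H hH E
    ((twistSubgroupH1EquivGeom V K hθ hc p H hH).symm s)
  rw [AddEquiv.apply_symm_apply] at step1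
  have step2 := mem_localKerOver_iff_model p hC H E ((twistSubgroupH1EquivGeom V K hθ hc p H hH).symm s)
  rw [step1] at step2
  -- the two `H¹`-transports agree
  have e : h1Equiv (G := H) ((twistPrimaryEquiv V K hθ hc p).symm.trans (primaryIso p hC)) hθH s =
      modelSubgroupH1Equiv p hC H ((twistSubgroupH1EquivGeom V K hθ hc p H hH).symm s) := by
    change resH1Hom _ _ _ s = resH1Hom _ _ _ (resH1Hom _ _ _ s)
    rw [resH1Hom_resH1Hom]
    exact congrFun (congrArg DFunLike.coe (resH1Hom_congr (by ext; rfl) (by ext; rfl) _ _)) s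
  rw [e]
  exact step2

/-! ## §3 The end theorem, instance -/

include h2 hθ hc in
/-- **'Greenberg ⊆ Kummer' over `ℚ_∞` for the additive curve `W = C • V^{(c)}` with the twisted
Greenberg datum `twistMap (reductionDatum V p) t`, `t = twistPrimaryEquiv⁻¹ ≫ primaryIso`** — in
GV's inertia currency at `ker κ`, CONDITIONAL ONLY on the typed Greenberg Prop. 2.4 (`hGrK`):
hypotheses `p ≠ 2`, `p ∤ Δ_V`, `p ∤ a_p(V)`, `κ` cyclotomic, `p ∈ v`, `ord_v c = 1`, `K = ℚ(θ)`,
`θ² = c`. [cite: GreenbergLNM1716, §2 Props. 2.2, 2.4 (pp. 73–75), §5 p. 143]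
[cite: GreenbergVatsal2000, §2 p. 26] -/
theorem greenbergKer_twistMap_geomTransport_le_localKerOver [V.IsElliptic] [V.IsGloballyMinimal]
    [Fact p.Prime] (κ : ZpExtension ℚ p) {v : HeightOneSpectrum (𝓞 ℚ)}
    (hGrK : imKummer_ge_strictCondition_goodOrdinary) (hp2 : p ≠ 2)
    (hΔ : ¬ (p : ℤ) ∣ V.minimalDiscriminantInt) (hord : ¬ (p : ℤ) ∣ V.frobeniusTrace p)
    (hκ : κ.IsCyclotomic) (hpv : ((p : ℕ) : 𝓞 ℚ) ∈ v.asIdeal)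
    (hval : v.valuation ℚ c = WithZero.exp (-1 : ℤ)) :
    (twistMap (reductionDatum V p hpv hΔ) ((twistPrimaryEquiv V K hθ hc p).symm.trans (primaryIso p hC))
        (geomTransport_sign V K h2 hθ hc p hC)).greenbergKer κ.kerSubgroup ≤
      W.localKerOver p κ.kerSubgroup (v.adicCompletion ℚ) :=
  greenbergKer_twistMap_kerSubgroup_le_localKerOver V p κ
    ((twistPrimaryEquiv V K hθ hc p).symm.trans (primaryIso p hC)) (geomTransport_sign V K h2 hθ hc p hC)
    K h2 hθ hc hGrK hp2 hΔ hord hκ hpv (fun _ hg m ↦ geomTransport_smul_of_mem V K hθ hc p hC hg m)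
    (exists_mem_absInertia_geomTransport_smul_eq_neg V K h2 hθ hc p hC hp2 hpv hval)
    (fun s ↦ mem_localKerOver_iff_h1Equiv_geomTransport V K hθ hc p hC _ inf_le_right _ _ s)

end Summit.BirchSwinnertonDyer.Rank1Residual.Additive.TameDescent

end
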